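import Summits.Ventures.HodgeKum4.Theses.KummerFixedLocus
import Literature.AlgebraicGeometry.Hyperkaehler.GeneralizedKummerFourTranslationFixedPoints

/-! # Birth skeleton — crux stmt-Ventures-19504 `Kum4FixedPointCountAtKummer` (THE POINT COUNT): the torsor road
Route route-Ventures-KummerFixedLocus (Ventures/HodgeKum4, rung H3).  Registered by plan g8 on director-hodge's
booking ruling 2026-08-26T08:09:37Z (4)(a); line card `Lines/birth.md`.
COUNT ⇐ print (Γ ≅ (ℤ/5)⁴, Floccari–Varesco) + print-synthesis (Γ transitive on Fix g, Oguiso 2020 Prop. 3.6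
proof; Literature fact p431381) + THE ATOM (H3) `Kum4FixedFourfoldHasFixedPointAtKummer` (@[conjecture], p431802),
composed by the kernel assembly `Summit.Ventures.HodgeKum4.kum4FixedPointCountAtKummer_of_transitive_of_hasFixedPoint`
(odd torsor p431546 + split sections p431571; owner seat p1, proposal p432427 `Theorems/KummerFixedLocusPointCountOfTorsor`,
PENDING at registration time — director de-dup ruling 2026-08-26T08:27:39Z; p2's byte-ready twin withdrawn to the rung
closer).  Until that decl is in the tree it is the stand-in stub `stub_assembly`; this skeleton is then re-registered
with `Kum4FixedPointCountAtKummer_of := that decl applied to the three remaining stubs`.  Sorries ONLY inside `stub_*`.  HONEST FRAMING: the composition is proved, the stubs are not;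
nothing here says (H3), the count, L3°, HC_Kum4Type or HC is proved. -/

open Literature.AlgebraicGeometry.Hyperkaehler

namespace Summit.Ventures.HodgeKum4.Cruxes.Kum4FixedPointCountAtKummer.Birth

/-- PRINT (refereed; Floccari–Varesco Math. Ann. 391 (2025) / Floccari G&T 30 (2026)): `Γ(X) ≃* (ZMod (n+1))⁴`
for X of Kumⁿ-type — here Γ(K) commutative of odd order 625.  Literature named fact; a hypothesis of every
closer, never proved in the tree. -/
theorem stub_card : FloccariVaresco2024_autFixingH2H3_equiv_kumType := by
  sorry

/-- PRINT-SYNTHESIS (Oguiso NMJ 239 (2020) Prop. 3.6 proof, d = 1, with BNWS Cor. 3.3(2); Literature fact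
p431381, arXiv:1208.3750 p0006:L18–L49): on K⁴(A), Γ(K) acts transitively on the fixed points of each g ∈ Γ ∖ 1. -/
theorem stub_transitive : Oguiso2020_translations_transitive_fixedPoints_generalizedKummerFour := by
  sorry

/-- THE ATOM (H3) (director-hodge 2026-08-26T08:09:37Z R1; cell, elementary, unpublished; @[conjecture] def
p431802; filed as the top-level item `Kum4FixedFourfoldHasFixedPointAtKummer`): on K⁴(A) the fixed fourfold W₀ of
every Kummer fixed datum contains a fixed point of every g ∈ Γ(K) ∖ 1. -/
theorem stub_hasFixedPoint : Summit.Ventures.HodgeKum4.Kum4FixedFourfoldHasFixedPointAtKummer := by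
  sorry

/-- STAND-IN for the kernel assembly `Summit.Ventures.HodgeKum4.kum4FixedPointCountAtKummer_of_transitive_of_hasFixedPoint`
(p1 p432427 PENDING, over J1 split sections p431571 + J3 odd torsor p431546 + datum clauses `IsKummerFixedDatum.conj_eq_inv` /
`.comp_hom`; scratch farm rc 0 per p1/director 08:27:39Z): print + transitivity + (H3) ⇒ the count.  A genuine ≈300-line
kernel lemma, not a restatement of the crux (it needs (H3)); DROPPED at re-registration once the decl is in the tree. -/
theorem stub_assembly :
    FloccariVaresco2024_autFixingH2H3_equiv_kumType →
    Oguiso2020_translations_transitive_fixedPoints_generalizedKummerFour →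
    Summit.Ventures.HodgeKum4.Kum4FixedFourfoldHasFixedPointAtKummer →
    Summit.Ventures.HodgeKum4.Kum4FixedPointCountAtKummer := by
  sorry

/-- Composition (kernel-checked; no `sorry` of its own — the stubs are applied BY NAME, as the skeleton audit
`#h21_check_skeleton` requires: a skeleton theorem may carry no hypothesis that is not a registered obligation):
the crux OF RECORD by name — the route decl `…Theses.KummerFixedLocus.Kum4FixedPointCountAtKummer`, which unfolds
to `Summit.Ventures.HodgeKum4.Kum4FixedPointCountAtKummer`, the conclusion of `stub_assembly`. -/
theorem Kum4FixedPointCountAtKummer_of :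
    Summit.Ventures.HodgeKum4.Theses.KummerFixedLocus.Kum4FixedPointCountAtKummer :=
  stub_assembly stub_card stub_transitive stub_hasFixedPoint

end Summit.Ventures.HodgeKum4.Cruxes.Kum4FixedPointCountAtKummer.Birth
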